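import Literature.MathematicalPhysics.QuantumFieldTheory.Balaban1983to89.Node00.OpsYLocalInverse
import Literature.MathematicalPhysics.QuantumFieldTheory.Balaban1983to89.B9Thm311DeltaPrimePos

/-!
# `Balaban1983to89.B9Thm311LocalInversePosY` — [B9] THEOREM 3.11's positivity AT THE LOCAL CUBE INVERSES of (3.79)/(3.87): the padded
# compression `P_□̃ Δ′_a(U) P_□̃ + (1 − P_□̃)` of def-Y's `Δ′_a(U)` IS POSITIVE DEFINITE — hence a UNIT — for EVERY cube and EVERY
# unitary-valued background, so def-Y's genuine local inverse `G′_□(U) = GsqY` inverts the compressed operator UNCONDITIONALLY at the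
# certificate's transporter `parSymY`, is positive, and the approximant `G′₀ = Σ_□ h_□ G′_□ h_□` of (3.87) is positive definite

statement-level skeleton of published theorems with citation tags; proofs where landed; nothing here is a claim about the
Yang–Mills mass gap

T. Bałaban, *Propagators for lattice gauge theories in a background field*, Commun. Math. Phys. **99** (1985) 389–434
[`Balaban1985BackgroundPropagators`, "[B9]"].  PDF held (`paper:balaban1985-cmp99-background-propagators`, journal page = PDF page + 388);
pp. 394–395, 406, 409, 416 re-read by this seat (2026-08-28).

THE PRINT (verbatim).  p. 395: *«Assuming some regularity of the configuration U it can be easily shown that the operator Δ′_a is positive.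
This implies positivity of the operators G′, Q′G′²Q′\*, hence the existence of the operator R.»*  p. 409, (3.87): *«We construct approximations
G′₀, C₀, G₀ of the operators G′, (Q′G′²Q′\*)⁻¹, G taking G′₀ = Σ_{□∈𝒟} h_□G′_□h_□, …»*.  p. 416, Theorem 3.11 and its proof: *«the operators
Δ′_a, G′, (Q′G′²Q′\*)⁻¹, Δ_a, G are positive definite. This is obvious for the first three operators … Thus we have to prove the positivity
of G₀. By the definition (3.87) it is enough to prove a positivity of the operators G_□.»*

WHY THIS FILE (cell context, pub-ymgap N06 DAG).  node00-def-Y's FILE 35 `Node00.OpsYLocalInverse` (p605048) made print's local cube inverse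
`G′_□(U)` a GENUINE letter: `GsqY i par D U = P_D · Ring.inverse (padDeltaY i par D U) · P_D`, `padDeltaY i par D U = P_D Δ′_a(U) P_D + (1 − P_D)`
(the padded Dirichlet compression to the site set `D = □̃`), and stated every inverse identity — `(P_D Δ′_a(U) P_D) G′_□(U) = P_D`, the (3.88)
property `h Δ′_a(U) G′_□(U) h = h²`, the (3.88) identity `eq388_GsqY` and the (3.90) fixed point — UNDER THE HYPOTHESIS `IsUnit (padDeltaY i par D U)`.
The knit (dag-n06-d ANSWER-W-a (a1), 2026-08-28) asked whether that invertibility is a displayed binder («Cor. 3.6's positivity, node content»)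
or a theorem.  IT IS A THEOREM, with no regularity and no constant: the padded compression inherits positive definiteness from `Δ′_a(U)`
itself (§2), and `Δ′_a(U)` over the inverse-symmetric transporter `parSymY` is positive definite for EVERY unitary-valued `U` (this lineage's
`B9Thm311DeltaPrimePos.deltaPrimeAY_parSymY_posDefTr`: (3.24) as a sum of squares + transport of flat sections).  The same compression lemma is
the U = 1 ∕ site-sector half of print's sentence «it is enough to prove a positivity of the operators G_□» (§4).

WHAT IS PROVED (sorry-free; 0 `def`; fibre `M_N(ℂ)`, print's real trace pairing `trIP w`, any positive weight `w` where stated).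
* §1 pairing bookkeeping for def-Y's real multipliers: `trIP_cutMulY_right` (a real cut-off `M_h` is symmetric for `⟨·,·⟩_w`),
  `trIP_cubeProjY_right ∕ _left` (the 0∕1 projection `P_D`), `one_sub_cubeProjY` (`1 − P_D = P_{D^c}`), `trIP_sum_right`.
* §2 ★ **COMPRESSION PRESERVES POSITIVE DEFINITENESS** `posDefTr_dirPadY_cubeProjY`: for ANY `ℂ`-linear `T` on `SiteY i → M_N(ℂ)` with `PosDefTr w T`,
  `PosDefTr w (P_D T P_D + (1 − P_D))` (`⟨Φ, (P T P + 1 − P)Φ⟩_w = ⟨PΦ, T PΦ⟩_w + ⟨P^cΦ, P^cΦ⟩_w`); hence ★ `posDefTr_padDeltaY_of_posDefTr`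
  (any transporter `par`) and `isUnit_padDeltaY_of_posDefTr`.
* §3 AT THE CERTIFICATE's TRANSPORTER `parSymY`, for `G ≤ U(N)` and every `G`-valued `U`, every site set `D`: ★★ `padDeltaY_parSymY_posDefTr`,
  ★★★ **`isUnit_padDeltaY_parSymY`** — the regime hypothesis of FILE 35 DISCHARGED; whence FILE 35's identities unconditionally:
  `compr_deltaPrimeAY_mul_GsqY_parSymY`, `GsqY_mul_compr_deltaPrimeAY_parSymY`, `cubeProjY_mul_deltaPrimeAY_mul_GsqY_parSymY`,
  ★ `cutMulY_deltaPrimeAY_GsqY_cutMulY_parSymY` (`h Δ′_a(U) G′_□(U) h = h²` for `supp h ⊆ D` — the `hloc` of (3.88)), ★ `eq388_GsqY_parSymY`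
  ((3.88) at the genuine local inverses, every unitary `U`), ★ `GpY_parSymY_eq_fixedPoint388` ((3.90) as a fixed point for def-Y's `G′(U) = GpY`).
* §4 POSITIVITY OF THE LOCAL INVERSES AND OF `G′₀` (p. 416): `trIP_GsqY_eq` (`⟨Ψ, G′_□Ψ⟩_w = ⟨P_DΨ, (padΔ)⁻¹ P_DΨ⟩_w`), ★ `trIP_GsqY_self_nonneg_of_posDefTr`
  ∕ `trIP_GsqY_self_pos_of_posDefTr` and their `parSymY` faces `trIP_GsqY_parSymY_self_nonneg ∕ _pos` (`G′_□(U) ≥ 0`, `> 0` on `P_DΨ ≠ 0`),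
  ★★ **`posDefTr_G0prime_of_posDefTr` ∕ `posDefTr_G0prime_parSymY`**: for any finite real family `h_c` with `Σ_c h_c(z)² = 1` and `supp h_c ⊆ D c`,
  `PosDefTr w (Σ_c M_{h_c} G′_{D c}(U) M_{h_c})` — print's «by the definition (3.87) it is enough to prove a positivity of the operators G_□»,
  realised for the site sector at every unitary `U`; `isUnit_G0prime_parSymY`.

HONEST SCOPE.  (i) Finite-dimensional positivity bookkeeping: no inequality of [B9] with a constant is proved or asserted (no Theorem 3.1 ∕ 3.6
bound for `G′_□`, no smallness of the (3.88) remainder).  (ii) The BOND-sector analogue (compressions of `Δ_a(U)`, print's `G_□`) is NOT claimed: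
§2's lemma transfers positivity from `Δ_a(U)` to its compressions, but positivity of `Δ_a(U)` is Theorem 3.11's analytic content (row 17 `hΔA` of the
N06 certificate; false without (3.35): `B9Thm311DeltaAFrustratedWitness`).  (iii) `𝔸 = M_N(ℂ)` (trace pairing), `G ≤ U(N)` (e.g. `SU(N)`), def-Y's
k-level index `i : KIdx`, transporter `parSymY` in §3 (§2 and the `_of_posDefTr` forms of §4 are transporter-generic).  Count-neutral (no new named
fact; N06 NOT discharged); nothing continuum, nothing about OS axioms or the mass gap.  No `sorry`, no `axiom`, no `instance`, no `notation`.
Seat `pub-ymgap-dag-n06-j` (bundle F5, rows 15–17), gen 20, 2026-08-28; NEW file; imports def-Y FILE 35 and this lineage's `B9Thm311DeltaPrimePos`; modifies nothing.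
-/

noncomputable section

namespace Literature.MathematicalPhysics.QuantumFieldTheory.Balaban1983to89.B9Thm311LocalInversePosY

open B9Thm311ReadingCoords B9Thm311DeltaPrimePos Node00 Node00.OpsYLocalInverse
open B9Thm37CubeCoverCommutators (cutMulY cutMulY_apply KhY)
open B6KLevelCensusIndexV1 (KIdx)
open scoped Matrix Matrix.Norms.L2Operator

/-! ## §1 Pairing bookkeeping: real multipliers and the cube projection are symmetric for print's pairing -/

section Pairing

variable {d ℓ : ℕ} {hd : 1 ≤ d + 1} {hL : Odd (ℓ + 1) ∧ 1 < ℓ + 1} {b₀ b₁ : ℝ} {N : ℕ}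
variable (i : KIdx d ℓ hd hL b₀ b₁)

/-- a REAL cut-off multiplier `M_h` is symmetric for the weighted trace pairing: `⟨Φ, hΨ⟩_w = ⟨hΦ, Ψ⟩_w`.
[cite: Balaban1985BackgroundPropagators, (3.87) p.409 (real h_□), p.393 (scalar products), bookkeeping] -/
theorem trIP_cutMulY_right (w : SiteY i → ℝ) (h : SiteY i → ℝ) (Φ Ψ : SiteY i → Matrix (Fin N) (Fin N) ℂ) :
    trIP w Φ (cutMulY h Ψ) = trIP w (cutMulY h Φ) Ψ := by
  unfold trIP
  refine Finset.sum_congr rfl fun s _ => ?_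
  congr 1
  refine Finset.sum_congr rfl fun a _ => Finset.sum_congr rfl fun b _ => ?_
  rw [cutMulY_apply, cutMulY_apply, Matrix.smul_apply, Matrix.smul_apply, smul_eq_mul, smul_eq_mul, star_mul',
    Complex.star_def, Complex.conj_ofReal]
  ring_nf

/-- the cube projection, paired on the right, only sees the part of the left argument inside the cube: `⟨Φ, P_DΨ⟩_w = ⟨P_DΦ, P_DΨ⟩_w`.
[cite: Balaban1985BackgroundPropagators, (3.79) p.406 (□̃), bookkeeping] -/
theorem trIP_cubeProjY_right (w : SiteY i → ℝ) (D : Finset (SiteY i)) (Φ Ψ : SiteY i → Matrix (Fin N) (Fin N) ℂ) :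
    trIP w Φ (cubeProjY i D Ψ) = trIP w (cubeProjY i D Φ) (cubeProjY i D Ψ) := by
  unfold trIP
  refine Finset.sum_congr rfl fun s _ => ?_
  congr 1
  refine Finset.sum_congr rfl fun a _ => Finset.sum_congr rfl fun b _ => ?_
  rw [cubeProjY_apply, cubeProjY_apply]
  split_ifs <;> simp

/-- and on the left: `⟨P_DΦ, Ψ⟩_w = ⟨P_DΦ, P_DΨ⟩_w`. [cite: Balaban1985BackgroundPropagators, (3.79) p.406, bookkeeping] -/
theorem trIP_cubeProjY_left (w : SiteY i → ℝ) (D : Finset (SiteY i)) (Φ Ψ : SiteY i → Matrix (Fin N) (Fin N) ℂ) :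
    trIP w (cubeProjY i D Φ) Ψ = trIP w (cubeProjY i D Φ) (cubeProjY i D Ψ) := by
  unfold trIP
  refine Finset.sum_congr rfl fun s _ => ?_
  congr 1
  refine Finset.sum_congr rfl fun a _ => Finset.sum_congr rfl fun b _ => ?_
  rw [cubeProjY_apply, cubeProjY_apply]
  split_ifs <;> simp

/-- hence `P_D` is symmetric: `⟨Φ, P_DΨ⟩_w = ⟨P_DΦ, Ψ⟩_w`. [cite: Balaban1985BackgroundPropagators, (3.79) p.406, bookkeeping] -/
theorem trIP_cubeProjY_symm (w : SiteY i → ℝ) (D : Finset (SiteY i)) (Φ Ψ : SiteY i → Matrix (Fin N) (Fin N) ℂ) :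
    trIP w Φ (cubeProjY i D Ψ) = trIP w (cubeProjY i D Φ) Ψ := by
  rw [trIP_cubeProjY_right]
  exact (trIP_cubeProjY_left i w D Φ Ψ).symm

/-- the complementary projection IS the projection of the complement: `1 − P_D = P_{univ ∖ D}`.
[cite: Balaban1985BackgroundPropagators, (3.79) p.406, bookkeeping] -/
theorem one_sub_cubeProjY (D : Finset (SiteY i)) :
    (1 : Module.End ℂ (SiteY i → Matrix (Fin N) (Fin N) ℂ)) - cubeProjY i D = cubeProjY i (Finset.univ \ D) := by
  refine LinearMap.ext fun Λ => funext fun z => ?_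
  rw [LinearMap.sub_apply, Module.End.one_apply, Pi.sub_apply, cubeProjY_apply, cubeProjY_apply]
  by_cases hz : z ∈ D
  · simp [hz]
  · simp [hz]

/-- `Φ` splits as `P_DΦ + P_{D^c}Φ`. [cite: Balaban1985BackgroundPropagators, (3.79) p.406, bookkeeping] -/
theorem cubeProjY_add_compl (D : Finset (SiteY i)) (Φ : SiteY i → Matrix (Fin N) (Fin N) ℂ) :
    cubeProjY i D Φ + cubeProjY i (Finset.univ \ D) Φ = Φ := by
  have h := congrArg (fun T : Module.End ℂ (SiteY i → Matrix (Fin N) (Fin N) ℂ) => T Φ) (one_sub_cubeProjY (N := N) i D)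
  simp only [LinearMap.sub_apply, Module.End.one_apply] at h
  rw [← h, add_sub_cancel]

/-- if `P_DΦ = 0` then `Φ` lives off the cube: `P_{D^c}Φ = Φ`. [cite: Balaban1985BackgroundPropagators, (3.79) p.406, bookkeeping] -/
theorem cubeProjY_compl_eq_self_of (D : Finset (SiteY i)) {Φ : SiteY i → Matrix (Fin N) (Fin N) ℂ} (h : cubeProjY i D Φ = 0) :
    cubeProjY i (Finset.univ \ D) Φ = Φ := by
  have := cubeProjY_add_compl (N := N) i D Φ
  rwa [h, zero_add] at this

/-- the pairing is additive in its right slot over finite sums. [cite: Balaban1985BackgroundPropagators, p.393 (scalar products), bookkeeping] -/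
theorem trIP_sum_right {ι : Type} (w : SiteY i → ℝ) (Φ : SiteY i → Matrix (Fin N) (Fin N) ℂ) (s : Finset ι)
    (Ψ : ι → SiteY i → Matrix (Fin N) (Fin N) ℂ) :
    trIP w Φ (∑ c ∈ s, Ψ c) = ∑ c ∈ s, trIP w Φ (Ψ c) := by
  classical
  induction s using Finset.induction_on with
  | empty => simp
  | insert c s hc ih => rw [Finset.sum_insert hc, Finset.sum_insert hc, trIP_add_right, ih]

end Pairing

/-! ## §2 Compression preserves positive definiteness -/

section Compression

variable {d ℓ : ℕ} {hd : 1 ≤ d + 1} {hL : Odd (ℓ + 1) ∧ 1 < ℓ + 1} {b₀ b₁ : ℝ} {N : ℕ}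
variable (i : KIdx d ℓ hd hL b₀ b₁)

/-- the padded compression, evaluated on the pairing: `⟨Φ, (P T P + (1 − P))Φ⟩_w = ⟨PΦ, T(PΦ)⟩_w + ⟨P^cΦ, P^cΦ⟩_w`.
[cite: Balaban1985BackgroundPropagators, (3.79) p.406, p.395, bookkeeping] -/
theorem trIP_dirPadY_cubeProjY_eq (w : SiteY i → ℝ) (D : Finset (SiteY i)) (T : Module.End ℂ (SiteY i → Matrix (Fin N) (Fin N) ℂ))
    (Φ : SiteY i → Matrix (Fin N) (Fin N) ℂ) :
    trIP w Φ (dirPadY (cubeProjY i D) T Φ)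
      = trIP w (cubeProjY i D Φ) (T (cubeProjY i D Φ))
        + trIP w (cubeProjY i (Finset.univ \ D) Φ) (cubeProjY i (Finset.univ \ D) Φ) := by
  rw [dirPadY, one_sub_cubeProjY, LinearMap.add_apply, Module.End.mul_apply, Module.End.mul_apply, trIP_add_right,
    trIP_cubeProjY_symm, ← trIP_cubeProjY_right]

/-- ★ **COMPRESSION PRESERVES POSITIVE DEFINITENESS**: if `T` is positive definite for `⟨·,·⟩_w` (`w > 0`), so is its padded compression
`P_D T P_D + (1 − P_D)` to any site set `D` — `⟨Φ, ·Φ⟩_w = ⟨P_DΦ, T P_DΦ⟩_w + ‖P_{D^c}Φ‖²_w`, and `Φ ≠ 0` forces one of the two to be positive.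
[cite: Balaban1985BackgroundPropagators, Thm 3.11 p.416 («it is enough to prove a positivity of the operators G_□»), (3.79) p.406] -/
theorem posDefTr_dirPadY_cubeProjY {w : SiteY i → ℝ} (hw : ∀ s, 0 < w s) (D : Finset (SiteY i))
    {T : Module.End ℂ (SiteY i → Matrix (Fin N) (Fin N) ℂ)} (hT : PosDefTr w T) :
    PosDefTr w (dirPadY (cubeProjY i D) T) := by
  intro Φ hΦ
  rw [trIP_dirPadY_cubeProjY_eq]
  by_cases hP : cubeProjY i D Φ = 0
  · rw [hP, map_zero, trIP_zero_right, zero_add, cubeProjY_compl_eq_self_of i D hP]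
    exact trIP_self_pos w hw hΦ
  · exact add_pos_of_pos_of_nonneg (hT _ hP) (trIP_self_nonneg w hw _)

/-- ★ hence for def-Y's `Δ′_a(U)` over ANY transporter: `PosDefTr w (Δ′_a(U)) → PosDefTr w (padDeltaY i par D U)`.
[cite: Balaban1985BackgroundPropagators, (3.79) p.406, Thm 3.11 p.416] -/
theorem posDefTr_padDeltaY_of_posDefTr {w : SiteY i → ℝ} (hw : ∀ s, 0 < w s) (par : SiteParY (Matrix (Fin N) (Fin N) ℂ) i)
    (D : Finset (SiteY i)) {U : CfgY (Matrix (Fin N) (Fin N) ℂ) i} (hΔ : PosDefTr w (deltaPrimeAY i par U)) :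
    PosDefTr w (padDeltaY i par D U) :=
  posDefTr_dirPadY_cubeProjY i hw D hΔ

/-- and the padded compression is then a UNIT of `End_ℂ` (FILE 35's regime hypothesis). [cite: Balaban1985BackgroundPropagators, (3.79) p.406, (3.25) p.395] -/
theorem isUnit_padDeltaY_of_posDefTr {w : SiteY i → ℝ} (hw : ∀ s, 0 < w s) (par : SiteParY (Matrix (Fin N) (Fin N) ℂ) i)
    (D : Finset (SiteY i)) {U : CfgY (Matrix (Fin N) (Fin N) ℂ) i} (hΔ : PosDefTr w (deltaPrimeAY i par U)) :
    IsUnit (padDeltaY i par D U) :=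
  isUnit_of_posDefTr (posDefTr_padDeltaY_of_posDefTr i hw par D hΔ)

end Compression

/-! ## §3 At the certificate's transporter `parSymY`: the regime hypothesis of FILE 35 discharged at every unitary background -/

section ParSym

variable {d ℓ : ℕ} {hd : 1 ≤ d + 1} {hL : Odd (ℓ + 1) ∧ 1 < ℓ + 1} {b₀ b₁ : ℝ} {N : ℕ}
variable (i : KIdx d ℓ hd hL b₀ b₁) {G : Subgroup (Matrix (Fin N) (Fin N) ℂ)ˣ}

/-- ★★ the padded compression of `Δ′_a(U)` to any cube is POSITIVE DEFINITE at every `G`-valued `U`, `G ≤ U(N)`.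
[cite: Balaban1985BackgroundPropagators, Thm 3.11 p.416, (3.24) pp.394–395, (3.79) p.406] -/
theorem padDeltaY_parSymY_posDefTr (hG : G ≤ B7Prop2Explicit.unitaryUnits (Matrix (Fin N) (Fin N) ℂ))
    {U : CfgY (Matrix (Fin N) (Fin N) ℂ) i} (hU : ∀ μ x, U μ x ∈ G) (D : Finset (SiteY i)) :
    PosDefTr (fun _ => (1 : ℝ)) (padDeltaY i (parSymY i) D U) :=
  posDefTr_padDeltaY_of_posDefTr i (fun _ => one_pos) (parSymY i) D (deltaPrimeAY_parSymY_posDefTr i hG hU)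

/-- ★★★ **FILE 35's REGIME HYPOTHESIS IS A THEOREM**: `IsUnit (padDeltaY i (parSymY i) D U)` for EVERY site set `D` at EVERY `G`-valued `U`,
`G ≤ U(N)` — no regularity (3.35), no constant. [cite: Balaban1985BackgroundPropagators, Thm 3.11 p.416, (3.79) p.406, (3.25) p.395] -/
theorem isUnit_padDeltaY_parSymY (hG : G ≤ B7Prop2Explicit.unitaryUnits (Matrix (Fin N) (Fin N) ℂ))
    {U : CfgY (Matrix (Fin N) (Fin N) ℂ) i} (hU : ∀ μ x, U μ x ∈ G) (D : Finset (SiteY i)) :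
    IsUnit (padDeltaY i (parSymY i) D U) :=
  isUnit_of_posDefTr (padDeltaY_parSymY_posDefTr i hG hU D)

/-- `(P_D Δ′_a(U) P_D) G′_□(U) = P_D`, unconditionally at `parSymY`. [cite: Balaban1985BackgroundPropagators, (3.79) p.406, (3.25) p.395] -/
theorem compr_deltaPrimeAY_mul_GsqY_parSymY (hG : G ≤ B7Prop2Explicit.unitaryUnits (Matrix (Fin N) (Fin N) ℂ))
    {U : CfgY (Matrix (Fin N) (Fin N) ℂ) i} (hU : ∀ μ x, U μ x ∈ G) (D : Finset (SiteY i)) :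
    cubeProjY i D * deltaPrimeAY i (parSymY i) U * cubeProjY i D * GsqY i (parSymY i) D U = cubeProjY i D :=
  compr_deltaPrimeAY_mul_GsqY i (parSymY i) (isUnit_padDeltaY_parSymY i hG hU D)

/-- `G′_□(U) (P_D Δ′_a(U) P_D) = P_D`, unconditionally at `parSymY`. [cite: Balaban1985BackgroundPropagators, (3.79) p.406, (3.25) p.395] -/
theorem GsqY_mul_compr_deltaPrimeAY_parSymY (hG : G ≤ B7Prop2Explicit.unitaryUnits (Matrix (Fin N) (Fin N) ℂ))
    {U : CfgY (Matrix (Fin N) (Fin N) ℂ) i} (hU : ∀ μ x, U μ x ∈ G) (D : Finset (SiteY i)) :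
    GsqY i (parSymY i) D U * (cubeProjY i D * deltaPrimeAY i (parSymY i) U * cubeProjY i D) = cubeProjY i D :=
  GsqY_mul_compr_deltaPrimeAY i (parSymY i) (isUnit_padDeltaY_parSymY i hG hU D)

/-- `P_D Δ′_a(U) G′_□(U) = P_D`, unconditionally at `parSymY`. [cite: Balaban1985BackgroundPropagators, (3.79) p.406, bookkeeping] -/
theorem cubeProjY_mul_deltaPrimeAY_mul_GsqY_parSymY (hG : G ≤ B7Prop2Explicit.unitaryUnits (Matrix (Fin N) (Fin N) ℂ))
    {U : CfgY (Matrix (Fin N) (Fin N) ℂ) i} (hU : ∀ μ x, U μ x ∈ G) (D : Finset (SiteY i)) :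
    cubeProjY i D * deltaPrimeAY i (parSymY i) U * GsqY i (parSymY i) D U = cubeProjY i D :=
  cubeProjY_mul_deltaPrimeAY_mul_GsqY i (parSymY i) (isUnit_padDeltaY_parSymY i hG hU D)

/-- ★ **the (3.88) local-inverse property `h Δ′_a(U) G′_□(U) h = h²`, UNCONDITIONALLY at `parSymY`**, for every real cut-off `h` supported in `D`.
[cite: Balaban1985BackgroundPropagators, (3.87)–(3.88) p.409, (3.79) p.406] -/
theorem cutMulY_deltaPrimeAY_GsqY_cutMulY_parSymY (hG : G ≤ B7Prop2Explicit.unitaryUnits (Matrix (Fin N) (Fin N) ℂ))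
    {U : CfgY (Matrix (Fin N) (Fin N) ℂ) i} (hU : ∀ μ x, U μ x ∈ G) {D : Finset (SiteY i)}
    (h : SiteY i → ℝ) (hD : ∀ z, h z ≠ 0 → z ∈ D) :
    cutMulY h * deltaPrimeAY i (parSymY i) U * GsqY i (parSymY i) D U * cutMulY h = cutMulY h * cutMulY h :=
  cutMulY_deltaPrimeAY_GsqY_cutMulY i (parSymY i) (isUnit_padDeltaY_parSymY i hG hU D) h hD

/-- ★ **(3.88) AT THE GENUINE LOCAL INVERSES, every unitary `U`**: `Δ′_a(U) G′₀ = 1 − Σ_c K(h_c) G′_{□_c}(U) h_c` for any real family with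
`Σ_c h_c² = 1`, `supp h_c ⊆ D c`. [cite: Balaban1985BackgroundPropagators, (3.87)–(3.88) p.409] -/
theorem eq388_GsqY_parSymY (hG : G ≤ B7Prop2Explicit.unitaryUnits (Matrix (Fin N) (Fin N) ℂ))
    (U : CfgY (Matrix (Fin N) (Fin N) ℂ) i) (hU : ∀ μ x, U μ x ∈ G) {ι : Type} [Fintype ι] (hf : ι → SiteY i → ℝ)
    (hsq : ∀ z, ∑ c, hf c z ^ 2 = 1) (D : ι → Finset (SiteY i)) (hD : ∀ c z, hf c z ≠ 0 → z ∈ D c) :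
    deltaPrimeAY i (parSymY i) U * (∑ c, cutMulY (hf c) * GsqY i (parSymY i) (D c) U * cutMulY (hf c))
      = 1 - ∑ c, KhY i (parSymY i) (hf c) U * GsqY i (parSymY i) (D c) U * cutMulY (hf c) :=
  eq388_GsqY i (parSymY i) U hf hsq D hD fun c => isUnit_padDeltaY_parSymY i hG hU (D c)

/-- ★ **(3.90) as a fixed point for def-Y's genuine `G′(U) = GpY`, every unitary `U`**: `G′ = G′₀ + G′·Σ_c K(h_c) G′_{□_c}(U) h_c` — both the local
and the global invertibility hypotheses of FILE 35's `GpY_eq_fixedPoint388` discharged. [cite: Balaban1985BackgroundPropagators, (3.90) p.409, (3.25) p.395] -/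
theorem GpY_parSymY_eq_fixedPoint388 (hG : G ≤ B7Prop2Explicit.unitaryUnits (Matrix (Fin N) (Fin N) ℂ))
    (U : CfgY (Matrix (Fin N) (Fin N) ℂ) i) (hU : ∀ μ x, U μ x ∈ G) {ι : Type} [Fintype ι] (hf : ι → SiteY i → ℝ)
    (hsq : ∀ z, ∑ c, hf c z ^ 2 = 1) (D : ι → Finset (SiteY i)) (hD : ∀ c z, hf c z ≠ 0 → z ∈ D c) :
    GpY i (parSymY i) U
      = (∑ c, cutMulY (hf c) * GsqY i (parSymY i) (D c) U * cutMulY (hf c))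
        + GpY i (parSymY i) U * ∑ c, KhY i (parSymY i) (hf c) U * GsqY i (parSymY i) (D c) U * cutMulY (hf c) :=
  GpY_eq_fixedPoint388 i (parSymY i) U hf hsq D hD (fun c => isUnit_padDeltaY_parSymY i hG hU (D c))
    (isUnit_deltaPrimeAY_parSymY i hG hU)

end ParSym

/-! ## §4 Positivity of the local inverses `G′_□(U)` and of `G′₀ = Σ_□ h_□ G′_□ h_□` (p. 416) -/

section Positivity

variable {d ℓ : ℕ} {hd : 1 ≤ d + 1} {hL : Odd (ℓ + 1) ∧ 1 < ℓ + 1} {b₀ b₁ : ℝ} {N : ℕ}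
variable (i : KIdx d ℓ hd hL b₀ b₁) {G : Subgroup (Matrix (Fin N) (Fin N) ℂ)ˣ}

/-- the form of the local inverse is the form of `(padΔ)⁻¹` on the projected argument: `⟨Ψ, G′_□(U)Ψ⟩_w = ⟨P_DΨ, (padΔ)⁻¹ P_DΨ⟩_w`.
[cite: Balaban1985BackgroundPropagators, (3.79) p.406, bookkeeping] -/
theorem trIP_GsqY_eq (w : SiteY i → ℝ) (par : SiteParY (Matrix (Fin N) (Fin N) ℂ) i) (D : Finset (SiteY i))
    (U : CfgY (Matrix (Fin N) (Fin N) ℂ) i) (Ψ : SiteY i → Matrix (Fin N) (Fin N) ℂ) :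
    trIP w Ψ (GsqY i par D U Ψ)
      = trIP w (cubeProjY i D Ψ) (Ring.inverse (padDeltaY i par D U) (cubeProjY i D Ψ)) := by
  rw [GsqY_def, Module.End.mul_apply, Module.End.mul_apply, trIP_cubeProjY_symm]

/-- ★ `G′_□(U) ≥ 0` whenever `Δ′_a(U)` is positive definite (any transporter): `0 ≤ ⟨Ψ, G′_□(U)Ψ⟩_w`.
[cite: Balaban1985BackgroundPropagators, Thm 3.11 p.416, p.395] -/
theorem trIP_GsqY_self_nonneg_of_posDefTr {w : SiteY i → ℝ} (hw : ∀ s, 0 < w s) (par : SiteParY (Matrix (Fin N) (Fin N) ℂ) i)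
    (D : Finset (SiteY i)) {U : CfgY (Matrix (Fin N) (Fin N) ℂ) i} (hΔ : PosDefTr w (deltaPrimeAY i par U))
    (Ψ : SiteY i → Matrix (Fin N) (Fin N) ℂ) : 0 ≤ trIP w Ψ (GsqY i par D U Ψ) := by
  rw [trIP_GsqY_eq]
  by_cases hP : cubeProjY i D Ψ = 0
  · rw [hP, map_zero, trIP_zero_right]
  · exact (posDefTr_ringInverse (posDefTr_padDeltaY_of_posDefTr i hw par D hΔ) _ hP).le

/-- ★ and `> 0` on arguments that meet the cube: `P_DΨ ≠ 0 → 0 < ⟨Ψ, G′_□(U)Ψ⟩_w`.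
[cite: Balaban1985BackgroundPropagators, Thm 3.11 p.416, p.395] -/
theorem trIP_GsqY_self_pos_of_posDefTr {w : SiteY i → ℝ} (hw : ∀ s, 0 < w s) (par : SiteParY (Matrix (Fin N) (Fin N) ℂ) i)
    (D : Finset (SiteY i)) {U : CfgY (Matrix (Fin N) (Fin N) ℂ) i} (hΔ : PosDefTr w (deltaPrimeAY i par U))
    {Ψ : SiteY i → Matrix (Fin N) (Fin N) ℂ} (hΨ : cubeProjY i D Ψ ≠ 0) : 0 < trIP w Ψ (GsqY i par D U Ψ) := by
  rw [trIP_GsqY_eq]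
  exact posDefTr_ringInverse (posDefTr_padDeltaY_of_posDefTr i hw par D hΔ) _ hΨ

/-- `G′_□(U) ≥ 0` at `parSymY`, every `G`-valued `U`, `G ≤ U(N)`. [cite: Balaban1985BackgroundPropagators, Thm 3.11 p.416] -/
theorem trIP_GsqY_parSymY_self_nonneg (hG : G ≤ B7Prop2Explicit.unitaryUnits (Matrix (Fin N) (Fin N) ℂ))
    {U : CfgY (Matrix (Fin N) (Fin N) ℂ) i} (hU : ∀ μ x, U μ x ∈ G) (D : Finset (SiteY i))
    (Ψ : SiteY i → Matrix (Fin N) (Fin N) ℂ) : 0 ≤ trIP (fun _ => (1 : ℝ)) Ψ (GsqY i (parSymY i) D U Ψ) :=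
  trIP_GsqY_self_nonneg_of_posDefTr i (fun _ => one_pos) (parSymY i) D (deltaPrimeAY_parSymY_posDefTr i hG hU) Ψ

/-- `G′_□(U) > 0` on arguments meeting the cube, at `parSymY`, every `G`-valued `U`. [cite: Balaban1985BackgroundPropagators, Thm 3.11 p.416] -/
theorem trIP_GsqY_parSymY_self_pos (hG : G ≤ B7Prop2Explicit.unitaryUnits (Matrix (Fin N) (Fin N) ℂ))
    {U : CfgY (Matrix (Fin N) (Fin N) ℂ) i} (hU : ∀ μ x, U μ x ∈ G) (D : Finset (SiteY i))
    {Ψ : SiteY i → Matrix (Fin N) (Fin N) ℂ} (hΨ : cubeProjY i D Ψ ≠ 0) : 0 < trIP (fun _ => (1 : ℝ)) Ψ (GsqY i (parSymY i) D U Ψ) :=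
  trIP_GsqY_self_pos_of_posDefTr i (fun _ => one_pos) (parSymY i) D (deltaPrimeAY_parSymY_posDefTr i hG hU) hΨ

/-- a cut-off supported in the cube is invisible to the projection: `P_D (hΨ) = hΨ`. [cite: Balaban1985BackgroundPropagators, (3.87) p.409, bookkeeping] -/
theorem cubeProjY_cutMulY_apply (h : SiteY i → ℝ) {D : Finset (SiteY i)} (hD : ∀ z, h z ≠ 0 → z ∈ D)
    (Ψ : SiteY i → Matrix (Fin N) (Fin N) ℂ) : cubeProjY i D (cutMulY h Ψ) = cutMulY h Ψ := by
  have := cubeProjY_mul_cutMulY (𝔸 := Matrix (Fin N) (Fin N) ℂ) i h hD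
  exact congrArg (fun T : Module.End ℂ (SiteY i → Matrix (Fin N) (Fin N) ℂ) => T Ψ) this

/-- a partition of unity `Σ_c h_c² = 1` that kills `Ψ` cut-off-wise kills `Ψ`. [cite: Balaban1985BackgroundPropagators, (3.87) p.409 («Σ h_□² = 1»), bookkeeping] -/
theorem eq_zero_of_cutMulY_eq_zero {ι : Type} [Fintype ι] (hf : ι → SiteY i → ℝ) (hsq : ∀ z, ∑ c, hf c z ^ 2 = 1)
    {Ψ : SiteY i → Matrix (Fin N) (Fin N) ℂ} (h0 : ∀ c, cutMulY (hf c) Ψ = 0) : Ψ = 0 := by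
  funext z
  have hz : ∀ c, ((hf c z : ℝ) : ℂ) • Ψ z = 0 := fun c => by
    have := congrFun (h0 c) z
    rwa [cutMulY_apply] at this
  have hsum : (∑ c, (((hf c z) ^ 2 : ℝ) : ℂ)) • Ψ z = 0 := by
    rw [Finset.sum_smul]
    refine Finset.sum_eq_zero fun c _ => ?_
    rw [Complex.ofReal_pow, sq, ← smul_smul, hz c, smul_zero]
  rw [← Complex.ofReal_sum, hsq z, Complex.ofReal_one, one_smul] at hsum
  exact hsum

/-- ★★ **`G′₀ = Σ_□ h_□ G′_□(U) h_□` IS POSITIVE DEFINITE** whenever `Δ′_a(U)` is (any transporter, any weight `w > 0`): for a finite real family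
`h_c` with `Σ_c h_c² = 1` and `supp h_c ⊆ D c`, `PosDefTr w (Σ_c M_{h_c} G′_{D c}(U) M_{h_c})` — print's «by the definition (3.87) it is enough to
prove a positivity of the operators G_□», site sector. [cite: Balaban1985BackgroundPropagators, Thm 3.11 p.416, (3.87) p.409] -/
theorem posDefTr_G0prime_of_posDefTr {w : SiteY i → ℝ} (hw : ∀ s, 0 < w s) (par : SiteParY (Matrix (Fin N) (Fin N) ℂ) i)
    {U : CfgY (Matrix (Fin N) (Fin N) ℂ) i} (hΔ : PosDefTr w (deltaPrimeAY i par U)) {ι : Type} [Fintype ι]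
    (hf : ι → SiteY i → ℝ) (hsq : ∀ z, ∑ c, hf c z ^ 2 = 1) (D : ι → Finset (SiteY i)) (hD : ∀ c z, hf c z ≠ 0 → z ∈ D c) :
    PosDefTr w (∑ c, cutMulY (hf c) * GsqY i par (D c) U * cutMulY (hf c)) := by
  intro Ψ hΨ
  have hsum : trIP w Ψ ((∑ c, cutMulY (hf c) * GsqY i par (D c) U * cutMulY (hf c) :
        Module.End ℂ (SiteY i → Matrix (Fin N) (Fin N) ℂ)) Ψ)
      = ∑ c, trIP w (cutMulY (hf c) Ψ) (GsqY i par (D c) U (cutMulY (hf c) Ψ)) := by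
    rw [LinearMap.sum_apply, trIP_sum_right]
    refine Finset.sum_congr rfl fun c _ => ?_
    rw [Module.End.mul_apply, Module.End.mul_apply, trIP_cutMulY_right]
  rw [hsum]
  have hnn : ∀ c ∈ Finset.univ, 0 ≤ trIP w (cutMulY (hf c) Ψ) (GsqY i par (D c) U (cutMulY (hf c) Ψ)) :=
    fun c _ => trIP_GsqY_self_nonneg_of_posDefTr i hw par (D c) hΔ _
  rcases (Finset.sum_nonneg hnn).lt_or_eq with hlt | heq
  · exact hlt
  · exfalso
    have hall := (Finset.sum_eq_zero_iff_of_nonneg hnn).mp heq.symm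
    refine hΨ (eq_zero_of_cutMulY_eq_zero i hf hsq fun c => ?_)
    by_contra hc
    have hPc : cubeProjY i (D c) (cutMulY (hf c) Ψ) ≠ 0 := by
      rwa [cubeProjY_cutMulY_apply i (hf c) (hD c)]
    exact (trIP_GsqY_self_pos_of_posDefTr i hw par (D c) hΔ hPc).ne' (hall c (Finset.mem_univ c))

/-- ★★ **`G′₀` OF (3.87) IS POSITIVE DEFINITE AT `parSymY` FOR EVERY `G`-VALUED `U`**, `G ≤ U(N)`, every real partition family `Σ_c h_c² = 1` with
`supp h_c ⊆ D c`. [cite: Balaban1985BackgroundPropagators, Thm 3.11 p.416, (3.87) p.409] -/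
theorem posDefTr_G0prime_parSymY (hG : G ≤ B7Prop2Explicit.unitaryUnits (Matrix (Fin N) (Fin N) ℂ))
    {U : CfgY (Matrix (Fin N) (Fin N) ℂ) i} (hU : ∀ μ x, U μ x ∈ G) {ι : Type} [Fintype ι]
    (hf : ι → SiteY i → ℝ) (hsq : ∀ z, ∑ c, hf c z ^ 2 = 1) (D : ι → Finset (SiteY i)) (hD : ∀ c z, hf c z ≠ 0 → z ∈ D c) :
    PosDefTr (fun _ => (1 : ℝ)) (∑ c, cutMulY (hf c) * GsqY i (parSymY i) (D c) U * cutMulY (hf c)) :=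
  posDefTr_G0prime_of_posDefTr i (fun _ => one_pos) (parSymY i) (deltaPrimeAY_parSymY_posDefTr i hG hU) hf hsq D hD

/-- hence `G′₀` is a unit of `End_ℂ` at every `G`-valued `U`. [cite: Balaban1985BackgroundPropagators, Thm 3.11 p.416, (3.90) p.409] -/
theorem isUnit_G0prime_parSymY (hG : G ≤ B7Prop2Explicit.unitaryUnits (Matrix (Fin N) (Fin N) ℂ))
    {U : CfgY (Matrix (Fin N) (Fin N) ℂ) i} (hU : ∀ μ x, U μ x ∈ G) {ι : Type} [Fintype ι]
    (hf : ι → SiteY i → ℝ) (hsq : ∀ z, ∑ c, hf c z ^ 2 = 1) (D : ι → Finset (SiteY i)) (hD : ∀ c z, hf c z ≠ 0 → z ∈ D c) :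
    IsUnit (∑ c, cutMulY (hf c) * GsqY i (parSymY i) (D c) U * cutMulY (hf c)) :=
  isUnit_of_posDefTr (posDefTr_G0prime_parSymY i hG hU hf hsq D hD)

end Positivity

end Literature.MathematicalPhysics.QuantumFieldTheory.Balaban1983to89.B9Thm311LocalInversePosY

end
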